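import Mathlib.Analysis.Calculus.MeanValue
import Mathlib.Analysis.Calculus.ContDiff.Basic
import Mathlib.Topology.MetricSpace.Equicontinuity
import HarnessLib

/-!
# Uniform `C^{k+1}` bounds make the `k`-th derivatives an equicontinuous (equi-Lipschitz) family
(topic `Analysis/Calculus`; the equicontinuity input of the `Cᵏ` Arzelà–Ascoli theorem —
Hörmander, *The Analysis of Linear Partial Differential Operators I*, Thm. 1.2.x / folklore;
Petersen 2006, Ch. 10, §3.1 (the `C^{m,α}` compactness behind Cheeger–Gromov convergence))

For a map `f` of class `C^n` on an open set `s` of a real normed space, `i + 1 ≤ n`, and a ball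
`B(x, r) ⊆ s` on which `‖D^{i+1} f‖ ≤ Λ`, the mean value inequality applied to `Dⁱ f` gives the
Lipschitz bound `‖Dⁱf(y) − Dⁱf(x)‖ ≤ Λ ‖y − x‖` on the ball
(`norm_iteratedFDeriv_sub_le_of_ball`); consequently a FAMILY of `C^n` maps with a common bound
`‖D^{i+1} f_j‖ ≤ Λ` on `s` has equicontinuous `i`-th derivatives on `s`
(`equicontinuousAt_iteratedFDeriv_of_bound`, `equicontinuousOn_iteratedFDeriv_of_bound`).
This is the equicontinuity half of the `Cᵏ` Arzelà–Ascoli theorem (`C^{k+1}`-bounded sequences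
have `Cᵏ_loc`-convergent subsequences), the per-chart analytic input of Cheeger–Gromov type
compactness theorems.

## References
* [Petersen2006] P. Petersen, *Riemannian Geometry*, 2nd ed., GTM 171, Springer 2006, Ch. 10, §3.1.
-/

noncomputable section

open Set Metric Filter Topology
open scoped ContDiff Topology

namespace Literature.Analysis.Calculus

variable {E F : Type*} [NormedAddCommGroup E] [NormedSpace ℝ E] [NormedAddCommGroup F]
  [NormedSpace ℝ F]

/-- On an open set the global iterated derivative of a `C^n` map is differentiable, of order
`i` with `i < n`. [folklore] -/
theorem differentiableAt_iteratedFDeriv_of_isOpen {f : E → F} {s : Set E} (hs : IsOpen s)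
    {n : WithTop ℕ∞} (hf : ContDiffOn ℝ n f s) {i : ℕ} (hi : (i : WithTop ℕ∞) < n) {x : E}
    (hx : x ∈ s) : DifferentiableAt ℝ (iteratedFDeriv ℝ i f) x := by
  have hd : DifferentiableOn ℝ (iteratedFDerivWithin ℝ i f s) s :=
    hf.differentiableOn_iteratedFDerivWithin hi hs.uniqueDiffOn
  have hd' : DifferentiableOn ℝ (iteratedFDeriv ℝ i f) s :=
    hd.congr fun y hy ↦ (iteratedFDerivWithin_of_isOpen i hs hy).symm
  exact hd'.differentiableAt (hs.mem_nhds hx)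

/-- **Lipschitz bound for iterated derivatives from a bound on the next one.** If `f` is `C^n` on
an open `s`, `i + 1 ≤ n`, `B(x, r) ⊆ s` and `‖D^{i+1} f‖ ≤ Λ` on `B(x, r)`, then
`‖Dⁱf(y) − Dⁱf(x)‖ ≤ Λ ‖y − x‖` for `y ∈ B(x, r)` (mean value inequality for `Dⁱ f` on the convex
ball, `‖D(Dⁱf)‖ = ‖D^{i+1}f‖`). [cite: Petersen2006, Ch. 10 §3.1] -/
theorem norm_iteratedFDeriv_sub_le_of_ball {f : E → F} {s : Set E} (hs : IsOpen s)
    {n : WithTop ℕ∞} (hf : ContDiffOn ℝ n f s) {i : ℕ} (hi : ((i + 1 : ℕ) : WithTop ℕ∞) ≤ n)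
    {x : E} {r : ℝ} (hB : ball x r ⊆ s) {Λ : ℝ}
    (hΛ : ∀ z ∈ ball x r, ‖iteratedFDeriv ℝ (i + 1) f z‖ ≤ Λ) {y : E} (hy : y ∈ ball x r) :
    ‖iteratedFDeriv ℝ i f y - iteratedFDeriv ℝ i f x‖ ≤ Λ * ‖y - x‖ := by
  have hr : 0 < r := pos_of_mem_ball hy
  have hi' : (i : WithTop ℕ∞) < n :=
    lt_of_lt_of_le (by exact_mod_cast Nat.lt_succ_self i) hi
  refine (convex_ball x r).norm_image_sub_le_of_norm_fderiv_le (𝕜 := ℝ)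
    (f := iteratedFDeriv ℝ i f) (fun z hz ↦ ?_) (fun z hz ↦ ?_) (mem_ball_self hr) hy
  · exact differentiableAt_iteratedFDeriv_of_isOpen hs hf hi' (hB hz)
  · rw [norm_fderiv_iteratedFDeriv]
    exact hΛ z hz

/-- **Equicontinuity of the `i`-th derivatives at a point** from a common bound on the
`(i+1)`-st derivatives of a family of `C^n` maps near the point. [cite: Petersen2006, Ch. 10 §3.1] -/
theorem equicontinuousAt_iteratedFDeriv_of_bound {ι : Type*} {f : ι → E → F} {s : Set E}
    (hs : IsOpen s) {n : WithTop ℕ∞} (hf : ∀ j, ContDiffOn ℝ n (f j) s) {i : ℕ}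
    (hi : ((i + 1 : ℕ) : WithTop ℕ∞) ≤ n) {Λ : ℝ}
    (hΛ : ∀ j, ∀ z ∈ s, ‖iteratedFDeriv ℝ (i + 1) (f j) z‖ ≤ Λ) {x : E} (hx : x ∈ s) :
    EquicontinuousAt (fun j ↦ iteratedFDeriv ℝ i (f j)) x := by
  obtain ⟨r, hr, hB⟩ := Metric.isOpen_iff.1 hs x hx
  refine Metric.equicontinuousAt_of_continuity_modulus (fun y ↦ |Λ| * ‖y - x‖) ?_ _ ?_
  · have h : Tendsto (fun y : E ↦ |Λ| * ‖y - x‖) (𝓝 x) (𝓝 (|Λ| * ‖x - x‖)) :=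
      ((continuous_id.sub continuous_const).norm.const_mul _).continuousAt
    rwa [sub_self, norm_zero, mul_zero] at h
  · filter_upwards [ball_mem_nhds x hr] with y hy j
    rw [dist_comm, dist_eq_norm]
    refine (norm_iteratedFDeriv_sub_le_of_ball hs (hf j) hi hB (fun z hz ↦ hΛ j z (hB hz))
      hy).trans ?_
    exact mul_le_mul_of_nonneg_right (le_abs_self Λ) (norm_nonneg _)

/-- **Equicontinuity of the `i`-th derivatives on an open set** from a common bound
`‖D^{i+1} f_j‖ ≤ Λ` on the set: the `i`-th derivatives of the family are equicontinuous on `s`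
(indeed locally equi-Lipschitz with constant `Λ`). [cite: Petersen2006, Ch. 10 §3.1] -/
theorem equicontinuousOn_iteratedFDeriv_of_bound {ι : Type*} {f : ι → E → F} {s : Set E}
    (hs : IsOpen s) {n : WithTop ℕ∞} (hf : ∀ j, ContDiffOn ℝ n (f j) s) {i : ℕ}
    (hi : ((i + 1 : ℕ) : WithTop ℕ∞) ≤ n) {Λ : ℝ}
    (hΛ : ∀ j, ∀ z ∈ s, ‖iteratedFDeriv ℝ (i + 1) (f j) z‖ ≤ Λ) :
    EquicontinuousOn (fun j ↦ iteratedFDeriv ℝ i (f j)) s := fun _ hx ↦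
  (equicontinuousAt_iteratedFDeriv_of_bound hs hf hi hΛ hx).equicontinuousWithinAt _

/-- The same family is **equicontinuous as a family of maps on the subtype `s`** (the form
consumed by `ArzelaAscoli.isCompact_of_equicontinuous` on the locally compact space `s`). [cite: Petersen2006, Ch. 10 §3.1] -/
theorem equicontinuous_restrict_iteratedFDeriv_of_bound {ι : Type*} {f : ι → E → F} {s : Set E}
    (hs : IsOpen s) {n : WithTop ℕ∞} (hf : ∀ j, ContDiffOn ℝ n (f j) s) {i : ℕ}
    (hi : ((i + 1 : ℕ) : WithTop ℕ∞) ≤ n) {Λ : ℝ}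
    (hΛ : ∀ j, ∀ z ∈ s, ‖iteratedFDeriv ℝ (i + 1) (f j) z‖ ≤ Λ) :
    Equicontinuous (fun j ↦ s.restrict (iteratedFDeriv ℝ i (f j))) :=
  (equicontinuous_restrict_iff _).2 (equicontinuousOn_iteratedFDeriv_of_bound hs hf hi hΛ)

/-- **Uniform bound of all orders `≤ k` at once**: under a common bound on the derivatives of
orders `1, …, k+1`, every `i`-th derivative with `i ≤ k` is an equicontinuous family on `s`. [cite: Petersen2006, Ch. 10 §3.1] -/
theorem equicontinuousOn_iteratedFDeriv_of_forall_bound {ι : Type*} {f : ι → E → F} {s : Set E}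
    (hs : IsOpen s) {k : ℕ} (hf : ∀ j, ContDiffOn ℝ (k + 1) (f j) s) {Λ : ℝ}
    (hΛ : ∀ j, ∀ i, 1 ≤ i → i ≤ k + 1 → ∀ z ∈ s, ‖iteratedFDeriv ℝ i (f j) z‖ ≤ Λ)
    {i : ℕ} (hi : i ≤ k) :
    EquicontinuousOn (fun j ↦ iteratedFDeriv ℝ i (f j)) s :=
  equicontinuousOn_iteratedFDeriv_of_bound hs hf (by exact_mod_cast Nat.succ_le_succ hi)
    fun j z hz ↦ hΛ j (i + 1) (Nat.succ_pos i) (Nat.succ_le_succ hi) z hz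

end Literature.Analysis.Calculus
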